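import Summits.AtomisticToContinuum.FouriersLaw.Theorems.PhononMeanFreePathIncoherentChannelForecastLossHarmonic

/-!
# `IncoherentChannel`, line `two-horizons-forecast-loss` — the ONE-TIME composition at every coupling
# `lam, β ≥ 0` (corner-capable form of `oneTime_coherent_of_tailBudget`)

Helper file for the lead's stub `oneTime_coherent_of_tailBudget_of_nonneg` (W-D) of crux
`PhononMeanFreePath.IncoherentChannel` (item stmt-AtomisticToContinuum-11811, route `PhononMeanFreePath`,
sub-problem `FouriersLaw`), vocabulary of `PhononMeanFreePathDefs`: `S_N(t) = fnorm … N t` (forecast norm of the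
far bath momentum), `r_N(t) = pairCorr … N t` (the coherent channel), `P_N(t) = commonPast … N t`.

THE POINT. The landed core lemma `oneTime_coherent_of_tailBudget` (file `…OneTimeEngine`) composes the TAIL
BUDGET `(2γ/T) ∫_{t>t₁} r_N(t)² dt ≤ S_N(t₁)` with the ONE-TIME hypothesis `N · S_N(N^η) → 0` (`η ∈ (0,1)`) into
`N ∫₀^∞ r_N² → 0`, but only at positive couplings `lam, β > 0` (it calls the positive-coupling light cone
`stub_lightCone` and the `β > 0` integrability lemma `IncoherentBounded.rN_sq_integrableOn`). The SAME composition
runs at every coupling `lam, β ≥ 0` — in particular at the harmonic corner `lam = β = 0`, where the lead refutes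
the one-time hypothesis against `HarmonicCoherentPersistence` — once the light cone is taken from the
corner-capable `lightConeH_of_nonneg` and the fixed-`N` integrability of `r_N²` on `(0,∞)` is taken as a
HYPOTHESIS. Pure assembly through the abstract window/tail lemma
`twoHorizons_tendsto_mul_integral_of_window_tail`. No definitions; nothing here closes an item.
-/

noncomputable section

namespace Summit.AtomisticToContinuum.FouriersLaw.Theorems.PhononMeanFreePath

open MeasureTheory Set Filter Topology
open scoped NNReal
open Literature.MathematicalPhysics.KineticTheory.HeatConduction

/-- **One-time engine ⇒ the coherent channel closes, at one parameter point with couplings `lam, β ≥ 0`**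
(corner-capable form of `oneTime_coherent_of_tailBudget`). For the pinned chain with `ω₂ > 0`, `lam, β ≥ 0`,
`γ > 0`, both baths at `T > 0`: if `t ↦ r_N(t)²` is integrable on `(0,∞)` for every `N`, the tail of the coherent
channel beyond any `t₁ ≥ 0` is budgeted by the forecast norm, `(2γ/T) ∫_{t>t₁} r_N(t)² dt ≤ S_N(t₁)`, and
`N · S_N(N^η) → 0` for some `η ∈ (0,1)`, then `N ∫₀^∞ r_N² → 0`. Split `(0,∞)` at `N^η`: inside, the light cone
`lightConeH_of_nonneg` gives `r_N² ≤ ε_N` with `N^{1+η} ε_N → 0`; beyond,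
`N ∫_{t>N^η} r_N² ≤ (T/2γ)·N·S_N(N^η) → 0`. [folklore] -/
theorem oneTime_coherent_of_tailBudget_of_nonneg : ∀ ω₂ lam β γ : ℝ, 0 < ω₂ → 0 ≤ lam → 0 ≤ β → 0 < γ → ∀ T : ℝ, 0 < T → (∀ N : ℕ, IntegrableOn (fun t => (pairCorr ω₂ lam β γ T N t) ^ 2) (Ioi (0 : ℝ))) → (∀ (N : ℕ) (t₁ : ℝ), 0 ≤ t₁ → (2 * γ / T) * ∫ s in Ioi t₁, (pairCorr ω₂ lam β γ T N s) ^ 2 ≤ fnorm ω₂ lam β γ T N t₁) → ∀ η : ℝ, 0 < η → η < 1 → Tendsto (fun N : ℕ => (N : ℝ) * fnorm ω₂ lam β γ T N ((N : ℝ) ^ η)) atTop (𝓝 0) → Tendsto (fun N : ℕ => (N : ℝ) * ∫ t in Ioi (0 : ℝ), (pairCorr ω₂ lam β γ T N t) ^ 2) atTop (𝓝 0) := by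
  intro ω₂ lam β γ hω hl hβ hγ T hT hint hTail η hη0 hη1 h1
  obtain ⟨ε, hε, hwin⟩ := lightConeH_of_nonneg ω₂ lam β γ hω hl hβ hγ.le T hT η hη0 hη1
  -- causal window `a N = N^η`, window level `ε N`, tail bound `(T/2γ)·(N·S_N(N^η))`
  set a : ℕ → ℝ := fun N => (N : ℝ) ^ η with ha
  have ha0 : ∀ N, 0 ≤ a N := fun N => Real.rpow_nonneg (Nat.cast_nonneg N) η
  have hγT : 0 < 2 * γ / T := by positivity
  refine twoHorizons_tendsto_mul_integral_of_window_tail (f := fun N t => (pairCorr ω₂ lam β γ T N t) ^ 2)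
    (a := a) (w := ε) (b := fun N => (T / (2 * γ)) * ((N : ℝ) * fnorm ω₂ lam β γ T N (a N)))
    ha0 hint ?_ ?_ ?_ ?_
  · -- inside the window: `r² ≤ |P| + r² ≤ ε_N`
    intro N t ht hta
    rw [abs_of_nonneg (sq_nonneg _)]
    have h := hwin N t ht.le hta
    linarith [abs_nonneg (commonPast ω₂ lam β γ T N t)]
  · -- beyond the window: the tail budget
    refine Eventually.of_forall (fun N => ?_)
    have habs : ∫ t in Ioi (a N), |(pairCorr ω₂ lam β γ T N t) ^ 2| =
        ∫ t in Ioi (a N), (pairCorr ω₂ lam β γ T N t) ^ 2 :=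
      integral_congr_ae (Eventually.of_forall fun t => abs_of_nonneg (sq_nonneg _))
    rw [habs]
    have h := hTail N (a N) (ha0 N)
    have hI : ∫ s in Ioi (a N), (pairCorr ω₂ lam β γ T N s) ^ 2 =
        (T / (2 * γ)) * ((2 * γ / T) * ∫ s in Ioi (a N), (pairCorr ω₂ lam β γ T N s) ^ 2) := by
      field_simp
    have h' : ∫ s in Ioi (a N), (pairCorr ω₂ lam β γ T N s) ^ 2 ≤
        (T / (2 * γ)) * fnorm ω₂ lam β γ T N (a N) := by
      rw [hI]
      exact mul_le_mul_of_nonneg_left h (by positivity)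
    calc (N : ℝ) * ∫ s in Ioi (a N), (pairCorr ω₂ lam β γ T N s) ^ 2
        ≤ (N : ℝ) * ((T / (2 * γ)) * fnorm ω₂ lam β γ T N (a N)) :=
          mul_le_mul_of_nonneg_left h' (Nat.cast_nonneg N)
      _ = (T / (2 * γ)) * ((N : ℝ) * fnorm ω₂ lam β γ T N (a N)) := by ring
  · -- window mass: `N · (ε_N · N^η) = N^{1+η} ε_N → 0`
    have hNa : ∀ N : ℕ, (N : ℝ) * (ε N * a N) = (N : ℝ) ^ (1 + η) * ε N := by
      intro N
      rw [ha, Real.rpow_add' (Nat.cast_nonneg N) (by linarith : (1:ℝ) + η ≠ 0), Real.rpow_one]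
      ring
    simp_rw [hNa]
    exact hε
  · -- tail mass: `(T/2γ)·(N·S_N(N^η)) → 0`
    simpa using h1.const_mul (T / (2 * γ))

end Summit.AtomisticToContinuum.FouriersLaw.Theorems.PhononMeanFreePath

end
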